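import Summits.Ventures.CertifiedManyBodySolver.Upper.ProducersFrameSourcedBoxNode
import Summits.Ventures.CertifiedManyBodySolver.Upper.GaugedShibaNambuEntries
import Literature.MathematicalPhysics.QuantumLattice.HubbardNNNHoppingOpenClusters
import HarnessLib

/-!
# Hopping OBSERVABLES in the producers' frame: `S′ᴴ · hamiltonian G t 0 · S′` in closed form, the diagonal
# (next-nearest-neighbour) table, and Rayleigh rows of any observable transported to the claim witness

HONEST FRAMING: first certified bounds; not a superconductivity verdict. Nothing here is a number or a row. IRD desk
(sr-mbsolver-ird-5); companion of `GaugedShibaDWaveSourceOpenBox.lean` (the transformed Hamiltonian `H̃`),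
`GaugedShibaNambuEntries.lean` (its term table) and `ProducersFrameSourcedBoxNode.lean` (rows ⇒ node).

hubbard-cq-obsth-2's ONE-OBSERVABLE ask (speedrun INBOX l.21251, co-signed hubbard-cq-lead l.21245): the NNN hopping
row `K₂ = Re⟨ψ, hamiltonian (rectBoxDiagGraph a b) 1 0 ψ⟩` of a certified W5 state, because pin-1's `t′` box is
`dWaveSourceOpenBoxTT' a b tp U μ h = dWaveSourceOpenBox a b U μ h + hamiltonian (rectBoxDiagGraph a b) tp 0`. Readers
certify Rayleigh rows of the TRANSFORMED operator on the integer MPS `ψ̃` of the certificate, in the frame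
`S′ = partialParticleHole D↓ · orbitalPhase g` (`g(r↓) = (−1)^{x+y}`, `g(r↑) = 1`). This file supplies:

* `partialParticleHole_conj_hamiltonian_zero` (any graph `G`): `W · H_G(t, U=0) · Wᴴ = dΓ(𝒦)`, `𝒦 = bdgNambuMatrix (−t[x∼y]) 0 0`
  — no constant, no interaction (tree `partialParticleHole_conj_hamiltonianWith` at `μ = U = 0`);
* `gaugedShiba_conj_hamiltonian_zero`, **`gaugedShiba'_conjTranspose_conj_hamiltonian_zero`**: the readers' operator
  `K̃ = S′ᴴ H_G(t,0) S′ = dΓ(𝒦^ḡ)`, `𝒦^ḡ_{ij} = ḡ_i g_j 𝒦_{ij}` — a pure one-body operator;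
* `gaugedHoppingNambuMatrix_orb_orb` (sign gauge `ε`): `(x↑,y↑) = −t[x∼y]`, `(x↓,y↓) = ε_x ε_y · t[x∼y]`, spin-off-diagonal `0`;
* `boxStagger_mul_of_diagAdj`: a DIAGONAL bond of the open box joins equal-parity sites, `ε_p ε_q = +1`; hence
  **`producersDiagHoppingMatrix_orb_orb`**: for `G = rectBoxDiagGraph a b` the `a`-modes hop with `−t` and the `b`-modes
  with `+t` along every diagonal (no stagger flip, no spin flip, no constant) — the word rule obsth-2 asked the producer to
  state (`744` words on `32 × 4`: `186` bonds × 2 orientations × 2 species);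
* `gaugedShiba'_conjTranspose_conj_onSiteRepulsion`: the `docc` observable `S′ᴴ(Σ n↑n↓)S′ = N↑ − Σ n↑n↓` (U-direction partner);
* transport of ANY observable's cleared Rayleigh rows to the normalised frame witness `ψ = S′ψ̃/‖ψ̃‖` of the claim node:
  `re_expect_normalisedFrame` (`Re⟨ψ, Xψ⟩ = Re⟨ψ̃, (SᴴXS)ψ̃⟩/⟨ψ̃,ψ̃⟩`), `star_dotProduct_normalisedFrame` (`‖ψ‖ = 1`),
  `observableLower_of_frameRow`, `observableUpper_of_frameRow` — so a THREE-ROW node (energy/density + zero-field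
  window + `k₂` window [+ docc]) about ONE witness follows conjunct by conjunct from the readers' rows.

References: E. H. Lieb, Phys. Rev. Lett. 62 (1989) 1201, proof of Thm 2 (the partial particle–hole transform);
H. Shiba, Prog. Theor. Phys. 48 (1972) 2171, §2. Tree: `partialParticleHole_conj_hamiltonianWith`, `orbitalPhase_conj_dGamma`,
`gaugedNambuMatrix_orb_orb`, `rectBoxDiagGraph`.
-/

noncomputable section
namespace Summit.Ventures.CertifiedManyBodySolver
open Matrix Finset Literature.Probability.LatticeModels
open Literature.MathematicalPhysics.QuantumLattice Literature.MathematicalPhysics.QuantumLattice.TwoCluster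
open Literature.Barriers.HubbardSuperconductivity HubbardWave0
open scoped ComplexOrder ComplexConjugate

section HoppingOperator

variable {Λ : Type*} [LinearOrder Λ] [Fintype Λ] (G : SimpleGraph Λ) [DecidableRel G.Adj]

/-- **Partial particle–hole transform of a pure hopping operator**: `W · hamiltonian G t 0 · Wᴴ = dΓ(𝒦)` with
`𝒦 = bdgNambuMatrix (−t[x∼y]) 0 0` (`↑↑` block `−t[x∼y]`, `↓↓` block `+t[x∼y]`; no constant since a graph has no loops,
no interaction since `U = 0`). [cite: Lieb1989, proof of Theorem 2] -/
theorem partialParticleHole_conj_hamiltonian_zero (t : ℝ) :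
    partialParticleHole (spinDownOrbitals : Finset (Orb Λ)) * hamiltonian G t 0 *
        (partialParticleHole (spinDownOrbitals : Finset (Orb Λ)))ᴴ =
      dGamma (bdgNambuMatrix (fun x y => if G.Adj x y then -(t : ℂ) else 0) 0 0) := by
  rw [← hamiltonianWith_zero G t 0, partialParticleHole_conj_hamiltonianWith]
  simp only [Complex.ofReal_zero, zero_mul, zero_smul, sub_zero, add_zero]

/-- The gauged transform: `(G·W) · hamiltonian G t 0 · (G·W)ᴴ = dΓ(𝒦^g)`, `𝒦^g_{ij} = g_i ḡ_j 𝒦_{ij}`.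
[cite: Lieb1989, proof of Theorem 2] -/
theorem gaugedShiba_conj_hamiltonian_zero (t : ℝ) {g : Orb Λ → ℂ} (hg : ∀ i, ‖g i‖ = 1) :
    orbitalPhase g * partialParticleHole (spinDownOrbitals : Finset (Orb Λ)) * hamiltonian G t 0 *
        (orbitalPhase g * partialParticleHole (spinDownOrbitals : Finset (Orb Λ)))ᴴ =
      dGamma (Matrix.of fun i j => g i * star (g j) *
        bdgNambuMatrix (fun x y => if G.Adj x y then -(t : ℂ) else 0) 0 0 i j) := by
  rw [gaugedShiba_conj_eq, partialParticleHole_conj_hamiltonian_zero, orbitalPhase_conj_dGamma hg]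

/-- **The readers' hopping observable in closed form**: for `S′ = partialParticleHole D↓ · orbitalPhase g`,
`K̃ = S′ᴴ · hamiltonian G t 0 · S′ = dΓ(𝒦^ḡ)`, `𝒦^ḡ_{ij} = ḡ_i g_j 𝒦_{ij}` — a particle-number-conserving ONE-BODY operator
in the transformed frame (the object an exact / interval reader evaluates on the certificate's integer MPS).
[cite: Lieb1989, proof of Theorem 2] -/
theorem gaugedShiba'_conjTranspose_conj_hamiltonian_zero (t : ℝ) {g : Orb Λ → ℂ} (hg : ∀ i, ‖g i‖ = 1) :
    (partialParticleHole (spinDownOrbitals : Finset (Orb Λ)) * orbitalPhase g)ᴴ * hamiltonian G t 0 *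
        (partialParticleHole (spinDownOrbitals : Finset (Orb Λ)) * orbitalPhase g) =
      dGamma (Matrix.of fun i j => star (g i) * g j *
        bdgNambuMatrix (fun x y => if G.Adj x y then -(t : ℂ) else 0) 0 0 i j) := by
  rw [gaugedShiba'_conjTranspose_conj_eq, partialParticleHole_conj_hamiltonian_zero,
    orbitalPhase_conj_dGamma (norm_star_phase hg)]
  congr 2
  funext i j
  simp only [Function.comp_apply, star_star]

/-- **Entries of the sign-gauged hopping matrix** (`g(x↑) = 1`, `g(x↓) = ε_x = ±1`):
`(x↑,y↑) = −t[x∼y]`, `(x↓,y↓) = ε_x ε_y · t[x∼y]`, `(x↑,y↓) = (x↓,y↑) = 0`. [cite: BachLiebSolovej1994, §2] -/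
theorem gaugedHoppingNambuMatrix_orb_orb (t : ℝ) {ε : Λ → ℂ} (hε : ∀ x, ε x = 1 ∨ ε x = -1) (x y : Λ) (σ σ' : Fin 2) :
    (Matrix.of fun i j : Orb Λ =>
        star (spinSitePhase (fun s z => if s = 1 then ε z else 1) i) *
          spinSitePhase (fun s z => if s = 1 then ε z else 1) j *
          bdgNambuMatrix (fun u v => if G.Adj u v then -(t : ℂ) else 0) 0 0 i j) (orb x σ) (orb y σ') =
      if σ = 0 then (if σ' = 0 then -(if G.Adj x y then (t : ℂ) else 0) else 0)
      else (if σ' = 0 then 0 else ε x * ε y * (if G.Adj x y then (t : ℂ) else 0)) := by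
  rw [gaugedNambuMatrix_orb_orb _ _ 0 hε x y σ σ']
  have hyx : G.Adj y x ↔ G.Adj x y := ⟨fun h => h.symm, fun h => h.symm⟩
  by_cases hσ : σ = 0 <;> by_cases hσ' : σ' = 0 <;>
    simp only [hσ, hσ', if_true, if_false, Pi.zero_apply, add_zero, star_zero, mul_zero, neg_zero,
      Complex.ofReal_zero, ite_self, sub_zero]
  · split_ifs <;> simp
  · rw [show (if G.Adj y x then -(t : ℂ) else 0) = (if G.Adj x y then -(t : ℂ) else 0) by simp only [hyx]]
    split_ifs <;> ring

end HoppingOperator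

section Box

variable (a b : ℕ)

/-- **A diagonal bond of the open box joins equal-parity sites**: `ε_p ε_q = +1` on every bond of `rectBoxDiagGraph a b`
(`|Δx| = |Δy| = 1`), `ε_p = (−1)^{x+y}` — in contrast with `boxStagger_mul_of_adj` (`−1` on nearest-neighbour bonds).
[folklore] -/
theorem boxStagger_mul_of_diagAdj {p q : Fin a ×ₗ Fin b} (h : (rectBoxDiagGraph a b).Adj p q) :
    (-1 : ℂ) ^ (((ofLex p).1 : ℕ) + ((ofLex p).2 : ℕ)) * (-1 : ℂ) ^ (((ofLex q).1 : ℕ) + ((ofLex q).2 : ℕ)) = 1 := by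
  rw [← pow_add]
  have heven : Even ((((ofLex p).1 : ℕ) + ((ofLex p).2 : ℕ)) + (((ofLex q).1 : ℕ) + ((ofLex q).2 : ℕ))) := by
    simp only [rectBoxDiagGraph, lineAdj] at h
    rw [Nat.even_iff]
    omega
  exact heven.neg_one_pow

/-- **The producers' diagonal-hopping table** (FORMAT-mpsgf1 §2 frame, `ε_p = (−1)^{x+y}` on the down orbitals,
`G = rectBoxDiagGraph a b`): `(p↑,q↑) = −t[p∼q]` (`a`-modes hop with `−t`), `(p↓,q↓) = +t[p∼q]` (`b`-modes hop with `+t`,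
because `ε_pε_q = +1` on diagonals), spin-off-diagonal `0`, no on-site term. With
`gaugedShiba'_conjTranspose_conj_hamiltonian_zero`: `K̃ = S′ᴴ · hamiltonian (rectBoxDiagGraph a b) t 0 · S′ = dΓ(this)`.
[cite: Lieb1989, proof of Theorem 2] -/
theorem producersDiagHoppingMatrix_orb_orb (t : ℝ) (p q : Fin a ×ₗ Fin b) (σ σ' : Fin 2) :
    (Matrix.of fun i j : Orb (Fin a ×ₗ Fin b) =>
        star (spinSitePhase (fun s z => if s = 1 then (-1 : ℂ) ^ (((ofLex z).1 : ℕ) + ((ofLex z).2 : ℕ)) else 1) i) *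
          spinSitePhase (fun s z => if s = 1 then (-1 : ℂ) ^ (((ofLex z).1 : ℕ) + ((ofLex z).2 : ℕ)) else 1) j *
          bdgNambuMatrix (fun u v : Fin a ×ₗ Fin b => if (rectBoxDiagGraph a b).Adj u v then -(t : ℂ) else 0) 0 0 i j)
        (orb p σ) (orb q σ') =
      if σ = 0 then (if σ' = 0 then -(if (rectBoxDiagGraph a b).Adj p q then (t : ℂ) else 0) else 0)
      else (if σ' = 0 then 0 else (if (rectBoxDiagGraph a b).Adj p q then (t : ℂ) else 0)) := by
  rw [gaugedHoppingNambuMatrix_orb_orb (rectBoxDiagGraph a b) t (boxStagger_eq_one_or a b) p q σ σ']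
  by_cases hσ : σ = 0 <;> by_cases hσ' : σ' = 0 <;> simp only [hσ, hσ', if_true, if_false]
  by_cases hadj : (rectBoxDiagGraph a b).Adj p q
  · rw [if_pos hadj, boxStagger_mul_of_diagAdj a b hadj, one_mul]
  · rw [if_neg hadj, mul_zero]

/-- The producers' `K̃` for the NNN observable, by name: `S′ᴴ · hamiltonian (rectBoxDiagGraph a b) t 0 · S′ = dΓ(𝒦̃)` with
`𝒦̃` the matrix tabulated in `producersDiagHoppingMatrix_orb_orb`. [cite: Lieb1989, proof of Theorem 2] -/
theorem producers_conjTranspose_conj_diagHopping (t : ℝ) :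
    (partialParticleHole (spinDownOrbitals : Finset (Orb (Fin a ×ₗ Fin b))) *
        orbitalPhase (spinSitePhase (fun s z => if s = 1 then (-1 : ℂ) ^ (((ofLex z).1 : ℕ) + ((ofLex z).2 : ℕ)) else 1)))ᴴ *
        hamiltonian (rectBoxDiagGraph a b) t 0 *
        (partialParticleHole (spinDownOrbitals : Finset (Orb (Fin a ×ₗ Fin b))) *
          orbitalPhase (spinSitePhase (fun s z => if s = 1 then (-1 : ℂ) ^ (((ofLex z).1 : ℕ) + ((ofLex z).2 : ℕ)) else 1))) =
      dGamma (Matrix.of fun i j : Orb (Fin a ×ₗ Fin b) =>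
        star (spinSitePhase (fun s z => if s = 1 then (-1 : ℂ) ^ (((ofLex z).1 : ℕ) + ((ofLex z).2 : ℕ)) else 1) i) *
          spinSitePhase (fun s z => if s = 1 then (-1 : ℂ) ^ (((ofLex z).1 : ℕ) + ((ofLex z).2 : ℕ)) else 1) j *
          bdgNambuMatrix (fun u v : Fin a ×ₗ Fin b => if (rectBoxDiagGraph a b).Adj u v then -(t : ℂ) else 0) 0 0 i j) :=
  gaugedShiba'_conjTranspose_conj_hamiltonian_zero (rectBoxDiagGraph a b) t
    (norm_spinSitePhase_sign (boxStagger_eq_one_or a b))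

end Box


section DoubleOccupancy

variable {Λ : Type*} [LinearOrder Λ] [Fintype Λ]

/-- **The double-occupancy observable in the producers' frame**: `S′ᴴ (Σ_x n_{x↑} n_{x↓}) S′ = N↑ − Σ_x n_{x↑} n_{x↓}`
(`S′ = partialParticleHole D↓ · orbitalPhase g`, `|g i| = 1`): the readers' `docc` row is `⟨N_a − Σ n^a n^b⟩` on the
transformed state — the `U`-direction partner of the `K₂` row (`E(U′) = E(U) + (U′ − U)·docc`). [cite: Lieb1989, proof of Theorem 2] -/
theorem gaugedShiba'_conjTranspose_conj_onSiteRepulsion {g : Orb Λ → ℂ} (hg : ∀ i, ‖g i‖ = 1) :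
    (partialParticleHole (spinDownOrbitals : Finset (Orb Λ)) * orbitalPhase g)ᴴ * (∑ x : Λ, numberOp x 0 * numberOp x 1) *
        (partialParticleHole (spinDownOrbitals : Finset (Orb Λ)) * orbitalPhase g) =
      (∑ x : Λ, numberOp x 0) - ∑ x : Λ, numberOp x 0 * numberOp x 1 := by
  rw [gaugedShiba'_conjTranspose_conj_eq, partialParticleHole_conj_onSiteRepulsion,
    ← orbitalPhaseAut_apply (norm_star_phase hg)]
  simp only [map_sub, map_sum, map_mul]
  simp only [orbitalPhaseAut_apply (norm_star_phase hg), orbitalPhase_conj_numberOp (norm_star_phase hg)]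

end DoubleOccupancy

section BoxNearestNeighbour

variable (a b : ℕ)

/-- **The producers' NEAREST-NEIGHBOUR hopping table** (`K₁`; `G = rectBoxGraph a b`, `ε_p = (−1)^{x+y}` on the down orbitals): because
the box is bipartite (`boxStagger_mul_of_adj`: `ε_pε_q = −1` on every bond) BOTH species hop with `−t` in the transformed frame —
`(p↑,q↑) = (p↓,q↓) = −t[p∼q]`, spin-off-diagonal `0`, no on-site term (the `U = μ = h = 0` slice of `producersNambuMatrix_orb_orb`). With
`gaugedShiba'_conjTranspose_conj_hamiltonian_zero`: `K̃₁ = S′ᴴ · hamiltonian (rectBoxGraph a b) t 0 · S′ = dΓ(this)` — the word rule of the readers'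
`K₁` row (E = K₁ + U·docc − μ₀N − κX decomposition check). [cite: Lieb1989, proof of Theorem 2] -/
theorem producersNNHoppingMatrix_orb_orb (t : ℝ) (p q : Fin a ×ₗ Fin b) (σ σ' : Fin 2) :
    (Matrix.of fun i j : Orb (Fin a ×ₗ Fin b) =>
        star (spinSitePhase (fun s z => if s = 1 then (-1 : ℂ) ^ (((ofLex z).1 : ℕ) + ((ofLex z).2 : ℕ)) else 1) i) *
          spinSitePhase (fun s z => if s = 1 then (-1 : ℂ) ^ (((ofLex z).1 : ℕ) + ((ofLex z).2 : ℕ)) else 1) j *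
          bdgNambuMatrix (fun u v : Fin a ×ₗ Fin b => if (rectBoxGraph a b).Adj u v then -(t : ℂ) else 0) 0 0 i j)
        (orb p σ) (orb q σ') =
      if σ = 0 then (if σ' = 0 then -(if (rectBoxGraph a b).Adj p q then (t : ℂ) else 0) else 0)
      else (if σ' = 0 then 0 else -(if (rectBoxGraph a b).Adj p q then (t : ℂ) else 0)) := by
  rw [gaugedHoppingNambuMatrix_orb_orb (rectBoxGraph a b) t (boxStagger_eq_one_or a b) p q σ σ']
  by_cases hσ : σ = 0 <;> by_cases hσ' : σ' = 0 <;> simp only [hσ, hσ', if_true, if_false]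
  by_cases hadj : (rectBoxGraph a b).Adj p q
  · rw [if_pos hadj, boxStagger_mul_of_adj a b hadj]
    ring
  · rw [if_neg hadj, mul_zero, neg_zero]

end BoxNearestNeighbour

section ObservableRows

variable {ι : Type*} [LinearOrder ι] [Fintype ι]

omit [LinearOrder ι] in
/-- **Rayleigh quotient of ANY observable at the normalised frame witness**: for a frame `S`, a vector `ψ̃` with
`R = ⟨ψ̃,ψ̃⟩ > 0` and `ψ := (1/√R) • Sψ̃`, `Re⟨ψ, Xψ⟩ = Re⟨ψ̃, (SᴴXS) ψ̃⟩ / R`. [folklore] -/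
theorem re_expect_normalisedFrame (S X : Matrix (Finset ι) (Finset ι) ℂ) (ψt : Fock ι) (hpos : 0 < (star ψt ⬝ᵥ ψt).re) :
    (star ((((1 / Real.sqrt (star ψt ⬝ᵥ ψt).re : ℝ)) : ℂ) • (S *ᵥ ψt)) ⬝ᵥ
        (X *ᵥ ((((1 / Real.sqrt (star ψt ⬝ᵥ ψt).re : ℝ)) : ℂ) • (S *ᵥ ψt)))).re =
      (star ψt ⬝ᵥ ((Sᴴ * X * S) *ᵥ ψt)).re / (star ψt ⬝ᵥ ψt).re := by
  rw [star_smul_dotProduct_mulVec_smul, star_mulVec_dotProduct_mulVec, Complex.re_ofReal_mul, div_mul_div_comm, one_mul,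
    Real.mul_self_sqrt hpos.le]
  ring

/-- The normalised frame witness is a unit vector when `Sᴴ S = 1`. [folklore] -/
theorem star_dotProduct_normalisedFrame {S : Matrix (Finset ι) (Finset ι) ℂ} (hS : Sᴴ * S = 1) (ψt : Fock ι)
    (hpos : 0 < (star ψt ⬝ᵥ ψt).re) :
    star ((((1 / Real.sqrt (star ψt ⬝ᵥ ψt).re : ℝ)) : ℂ) • (S *ᵥ ψt)) ⬝ᵥ
        ((((1 / Real.sqrt (star ψt ⬝ᵥ ψt).re : ℝ)) : ℂ) • (S *ᵥ ψt)) = 1 := by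
  set R : ℝ := (star ψt ⬝ᵥ ψt).re with hR
  have hself : star ψt ⬝ᵥ ψt = (R : ℂ) := by
    rw [star_dotProduct_self_eq_eucNorm_sq, hR, ← eucNorm_sq]
  have := star_smul_dotProduct_mulVec_smul (1 / Real.sqrt R) (1 : Matrix _ _ ℂ) (S *ᵥ ψt)
  rw [one_mulVec, one_mulVec] at this
  rw [this, star_mulVec_dotProduct_mulVec_self_of_unitary hS, hself, ← Complex.ofReal_mul, div_mul_div_comm, one_mul,
    Real.mul_self_sqrt hpos.le, div_mul_cancel₀ _ (ne_of_gt hpos), Complex.ofReal_one]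

omit [LinearOrder ι] in
/-- **A cleared LOWER Rayleigh row transports to the witness**: `lo·c·⟨ψ̃,ψ̃⟩ ≤ Re⟨ψ̃,(SᴴXS)ψ̃⟩` gives `lo·c ≤ Re⟨ψ, Xψ⟩`
(`c` = the row's scale, e.g. `ab`). [folklore] -/
theorem observableLower_of_frameRow (S X : Matrix (Finset ι) (Finset ι) ℂ) (ψt : Fock ι)
    (hpos : 0 < (star ψt ⬝ᵥ ψt).re) {lo c : ℝ}
    (hrow : lo * c * (star ψt ⬝ᵥ ψt).re ≤ (star ψt ⬝ᵥ ((Sᴴ * X * S) *ᵥ ψt)).re) :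
    lo * c ≤ (star ((((1 / Real.sqrt (star ψt ⬝ᵥ ψt).re : ℝ)) : ℂ) • (S *ᵥ ψt)) ⬝ᵥ
        (X *ᵥ ((((1 / Real.sqrt (star ψt ⬝ᵥ ψt).re : ℝ)) : ℂ) • (S *ᵥ ψt)))).re := by
  rw [re_expect_normalisedFrame S X ψt hpos]
  exact (le_div_iff₀ hpos).2 hrow

omit [LinearOrder ι] in
/-- **A cleared UPPER Rayleigh row transports to the witness**: `Re⟨ψ̃,(SᴴXS)ψ̃⟩ ≤ hi·c·⟨ψ̃,ψ̃⟩` gives `Re⟨ψ, Xψ⟩ ≤ hi·c`.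
[folklore] -/
theorem observableUpper_of_frameRow (S X : Matrix (Finset ι) (Finset ι) ℂ) (ψt : Fock ι)
    (hpos : 0 < (star ψt ⬝ᵥ ψt).re) {hi c : ℝ}
    (hrow : (star ψt ⬝ᵥ ((Sᴴ * X * S) *ᵥ ψt)).re ≤ hi * c * (star ψt ⬝ᵥ ψt).re) :
    (star ((((1 / Real.sqrt (star ψt ⬝ᵥ ψt).re : ℝ)) : ℂ) • (S *ᵥ ψt)) ⬝ᵥ
        (X *ᵥ ((((1 / Real.sqrt (star ψt ⬝ᵥ ψt).re : ℝ)) : ℂ) • (S *ᵥ ψt)))).re ≤ hi * c := by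
  rw [re_expect_normalisedFrame S X ψt hpos]
  exact (div_le_iff₀ hpos).2 hrow

end ObservableRows

end Summit.Ventures.CertifiedManyBodySolver
end
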